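import Summits.CriticalPhenomena.CardyFormulaZ2.Theorems.CardySelfRefinementLagHandOffLimitCurveRegularityNoTrace
import Summits.CriticalPhenomena.CardyFormulaZ2.Theorems.CardySelfRefinementLagHandOffKernelNearTraceClosed
import Summits.CriticalPhenomena.CardyFormulaZ2.Theorems.CardySelfRefinementLagHandOffKernelNullLimit
import Summits.CriticalPhenomena.CardyFormulaZ2.Theorems.LagHandOff.Negative.DictionaryMerging
import Mathlib.Topology.MetricSpace.Thickening
import HarnessLib

/-!
# No near-tracing of the boundary, uniformly along the interfaces: stub
`stub_kernel_noNearTrace_uniform` (K9c) of line `hitting-tournament` for crux `LagHandOff`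
(stmt-CriticalPhenomena-10268)

Soft half of the boundary kernel (KERNEL-c5 §2), assembled.  Along positive meshes `δₙ → 0`, let
the interface laws of an admissible `ℤ²`-discretisation family `E` of the Dobrushin domain
`(D; a, b)` converge weakly to a probability measure `ν` on `CurveClass ℂ`.  Then for every length
`η > 0` and every `θ > 0` there is a radius `ε > 0` such that, for all large `n`, the probability
that the `n`-th interface has a sub-arc of diameter `≥ η` inside the closed `ε`-neighbourhood of
`∂D` is `< θ`.

Proof (pure assembly of three landed inputs).  With `F := frontier D.carrier` (closed) and the
near-tracing events `A ε := NT_ε(η, F)`, `A₀ := NT_0(η, F)`: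

* `A ε` is closed for `ε ≥ 0` and `⋂_{ε > 0} A ε ⊆ A₀` — `stub_kernel_nearTrace_closed` (K9a);
* `A` is monotone in `ε` — `Metric.cthickening_mono`;
* `ν A₀ = 0` — the no-tracing theorem `stub_limitCurveRegularity_noTrace`: `ν`-a.e. every
  sub-arc of every representative lying inside `∂D` is a subsingleton, hence has diameter
  `0 < η` (`Metric.diam_subsingleton`), so `A₀` sits inside the exceptional null set;
* the interfaces are measurable at positive mesh —
  `Theorems.LagHandOff.Negative.measurable_bondInterfaceIn_family`;

and the abstract portmanteau step `stub_kernel_eventually_small_of_null_limit` (K9b) applied to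
`P := bondPercolation (zdGraph 2) half`, `Y n := bondInterfaceIn D (E (δs n))` concludes.
-/

noncomputable section

open Set Metric MeasureTheory Filter Topology
open scoped unitInterval BoundedContinuousFunction ENNReal
open Literature.Probability.Percolation Literature.Probability.LatticeModels
open Literature.Probability.RandomPlanarGeometry

namespace Summit.CriticalPhenomena.CardyFormulaZ2.Cruxes.LagHandOff.HittingTournament

/-- **The tracing event is null for interface limits.** For a weak limit `ν` of the interface
laws along positive meshes `δₙ → 0` and every `η > 0`, the event "some representative has a
sub-arc `c[s, t]`, `s < t`, of diameter `≥ η` inside `∂D`" is `ν`-null: by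
`stub_limitCurveRegularity_noTrace` such a sub-arc is a.s. a subsingleton, of diameter `0`. -/
theorem measure_traceEvent_eq_zero (D : DobrushinDomain) (E : ℝ → DiscreteDobrushin)
    (hE : ZdDiscretisationFamily D E) (δs : ℕ → ℝ) (hpos : ∀ n, 0 < δs n)
    (hlim : Tendsto δs atTop (𝓝 0)) (ν : Measure (CurveClass ℂ)) [IsProbabilityMeasure ν]
    (hconv : ∀ f : CurveClass ℂ →ᵇ ℝ,
      Tendsto (fun n => ∫ ω, f (bondInterfaceIn D (E (δs n)) ω)
        ∂(bondPercolation (zdGraph 2) half)) atTop (𝓝 (∫ γ, f γ ∂ν)))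
    {η : ℝ} (hη : 0 < η) :
    ν {γ : CurveClass ℂ | ∃ c : Curve ℂ, CurveClass.mk c = γ ∧
        ∃ s t : unitInterval, s < t ∧ η ≤ Metric.diam (c '' Set.Icc s t) ∧
          c '' Set.Icc s t ⊆ frontier D.carrier} = 0 := by
  have hae := stub_limitCurveRegularity_noTrace D E hE δs hpos hlim ν hconv
  rw [ae_iff] at hae
  refine measure_mono_null ?_ hae
  rintro γ ⟨c, hc, s, t, hst, hd, hsub⟩ hall
  have h0 : diam (c '' Icc s t) = 0 := diam_subsingleton (hall c hc s t hst hsub)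
  rw [h0] at hd
  exact absurd hd (not_le.2 hη)

/-- **K9c `stub_kernel_noNearTrace_uniform`.** Along positive meshes `δₙ → 0` with interface laws
converging weakly to a probability measure `ν`: for every `η > 0` and `θ > 0` there is `ε > 0`
such that eventually in `n` the probability that the `n`-th interface of `(D, E)` has a sub-arc of
diameter `≥ η` inside `Metric.cthickening ε (frontier D.carrier)` is `< θ`.  Assembly of
`stub_kernel_nearTrace_closed` (closedness, intersection), `Metric.cthickening_mono`
(monotonicity), `measure_traceEvent_eq_zero` (null limit event, from the no-tracing theorem),
`measurable_bondInterfaceIn_family` and `stub_kernel_eventually_small_of_null_limit`. -/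
theorem stub_kernel_noNearTrace_uniform :
    ∀ (D : DobrushinDomain) (E : ℝ → DiscreteDobrushin), ZdDiscretisationFamily D E →
      ∀ δs : ℕ → ℝ, (∀ n, 0 < δs n) → Tendsto δs atTop (𝓝 0) →
        ∀ (ν : Measure (CurveClass ℂ)) [IsProbabilityMeasure ν],
          (∀ f : CurveClass ℂ →ᵇ ℝ,
            Tendsto (fun n => ∫ ω, f (Literature.Probability.Percolation.bondInterfaceIn D (E (δs n)) ω)
              ∂(bondPercolation (zdGraph 2) half)) atTop (𝓝 (∫ γ, f γ ∂ν))) →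
          ∀ η : ℝ, 0 < η → ∀ θ : ℝ≥0∞, 0 < θ → ∃ ε : ℝ, 0 < ε ∧ ∀ᶠ n in atTop,
            (bondPercolation (zdGraph 2) half)
              ((Literature.Probability.Percolation.bondInterfaceIn D (E (δs n))) ⁻¹'
                {γ : CurveClass ℂ | ∃ c : Curve ℂ, CurveClass.mk c = γ ∧
                  ∃ s t : unitInterval, s < t ∧ η ≤ Metric.diam (c '' Set.Icc s t) ∧
                    c '' Set.Icc s t ⊆ Metric.cthickening ε (frontier D.carrier)}) < θ := by
  intro D E hE δs hpos hlim ν _ hconv η hη θ hθ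
  obtain ⟨hcl, hint⟩ := stub_kernel_nearTrace_closed (frontier D.carrier) isClosed_frontier η hη
  have hY : ∀ n, Measurable (bondInterfaceIn D (E (δs n))) := fun n =>
    Theorems.LagHandOff.Negative.measurable_bondInterfaceIn_family hE (hpos n)
  refine stub_kernel_eventually_small_of_null_limit (bondPercolation (zdGraph 2) half)
    (fun n => bondInterfaceIn D (E (δs n))) hY ν hconv
    (fun ε => {γ : CurveClass ℂ | ∃ c : Curve ℂ, CurveClass.mk c = γ ∧
      ∃ s t : unitInterval, s < t ∧ η ≤ Metric.diam (c '' Set.Icc s t) ∧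
        c '' Set.Icc s t ⊆ Metric.cthickening ε (frontier D.carrier)})
    {γ : CurveClass ℂ | ∃ c : Curve ℂ, CurveClass.mk c = γ ∧
      ∃ s t : unitInterval, s < t ∧ η ≤ Metric.diam (c '' Set.Icc s t) ∧
        c '' Set.Icc s t ⊆ frontier D.carrier}
    (fun ε hε => hcl ε hε.le) ?_ hint
    (measure_traceEvent_eq_zero D E hE δs hpos hlim ν hconv hη) θ hθ
  -- monotonicity in the radius
  rintro ε ε' - hle γ ⟨c, hc, s, t, hst, hd, hsub⟩
  exact ⟨c, hc, s, t, hst, hd, hsub.trans (cthickening_mono hle _)⟩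

end Summit.CriticalPhenomena.CardyFormulaZ2.Cruxes.LagHandOff.HittingTournament

end
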